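import Summits.HodgeConjecture.HodgeConjecture.Theorems.Ring2AbelianAllLefschetzPencilsWeil
import Literature.AlgebraicGeometry.HodgeTheory.LefschetzStandardUnconditionalDegrees
import Literature.AlgebraicGeometry.HodgeTheory.WeilClassesFourfolds
import HarnessLib

/-!
# Ring 2 · sub-cell AbelianAll (ALL ABELIAN VARIETIES), André axis — ab-andre-1 part IX: the RUNGS of the graded
# Lefschetz ladder `(5∀)_d` / `(5)_d` — `d ≤ 1` closed in the kernel, the exact degree cost of `(5∀)_d`, the
# COFINALITY of the cell row in the relative dimension, and the first rung with an open transport input (`d = 4`)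

HONEST FRAMING (page 1, verbatim): **research route, not a corollary; conditional on HC_CM plus one named
minimal statement.** Cell line: research route conditional on HC_CM; not a corollary; Q11.4-sentence-2
already refuted in dim ≥ 3. Nothing in this file proves an open case of the Hodge conjecture. `HC_CM` =
`Theses.RankFourFaces.CMAbelianHodge` (a BINDER, never cited as a fact), `HC_AV` =
`Theses.PadicSemiregularLift.HodgeAbelianVarieties`; the item `Theses.RankFourFaces.CMToAbelian`
(stmt-HodgeConjecture-16267) is OPEN and not closed here; the named facts `h₈`
(`Abdulali1994_invariantCycles_of_lefschetzStandard`) and `h₂₁` (`andre1996_cmAnchoredPencil`) are BINDERS, displayed.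
Seat `pub-hodge-ring2-ab-andre-1`, gen 5; sequel of parts VII (`Ring2AbelianAllLefschetzPencilsGraded`: the graded
nodes `(5∀)_d = LefschetzBCompactPencilsAtRelDim d`, `(5)_d = LefschetzBCMPointedPencilsAtRelDim d`, the foot `d = 0`)
and VIII (`Ring2AbelianAllLefschetzPencilsWeil`: the Weil column from `(5)_{2n}`), written on the literature seat's
`LefschetzStandardUnconditionalDegrees` (p201770: `B` for every smooth projective complex SURFACE on the carriers,
and "`B(X)` needs `HC(X × X)` in codimensions `2 ≤ b ≤ dim X − 1` only").

## Content (every theorem a short composition BY NAME; count once)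

* §I RUNGS `d ≤ 1` CLOSED IN THE KERNEL: `(5∀)_1` (`lefschetzBCompactPencilsAtRelDim_one`: the total space of a
  compact pencil of elliptic curves is a smooth projective surface, and `B(S)` holds for every surface —
  `standardConjectureBStar_of_isCompactAbelianPencil_one`, Grothendieck / Kleiman 1968 / Murre §7.7), hence `(5)_1`;
  with part VII's foot `d = 0`: `(5∀)_d`, `(5)_d` for all `d ≤ 1`, and the blanket nodes are EQUIVALENT to their
  restrictions to `d ≥ 2` (`lefschetzBCompactPencils_iff_forall_two_le`, `lefschetzBCMPointedPencils_iff_forall_two_le`).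
* §J THE EXACT DEGREE COST of `(5∀)_d` (graded on-path, sharper than part VII's
  `lefschetzBCompactPencilsAtRelDim_of_hodgeConjectureFor_sq`): `(5∀)_d` follows from the algebraicity of the rational
  `(b,b)`-classes of the `(2d+2)`-folds `𝒳 × 𝒳` in the codimensions `2 ≤ b ≤ d` ONLY (`𝒳` ranging over the total
  spaces of compact pencils of abelian `d`-folds; `…_of_hodgeClasses_sq_range`, and the CM-pointed variant); at `d = 2`
  the single input is the rational `(2,2)`-classes of the SIXFOLDS `𝒳 × 𝒳` (`…_two_of_codimTwo_sq`). Fact-free.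
* §K COFINALITY OF THE CELL ROW in the relative dimension: `HCAtDim` is monotone (`ClassTargets.hcAtDim_mono`, the
  product trick), so `HC_AV` follows from `HC_CM` and the transport input `CMAnchoredTransportAtRelDim (2g)` (andre-2)
  — resp. from `HC_CM` and `(5)_{2g}`, granted `h₈` — for any COFINAL set of `g` (`…_of_frequently_…`), in particular
  from `∀ g ≥ 4` alone (`…_of_forall_ge_four_…`): through the Lemme 6.3.1 row the rungs `(5)_d`, `d ≤ 7`, are IDLE
  for `HC_AV` (they return `HCAtDim g`, `g ≤ 3`, a theorem of the tree, `ClassTargets.hcAtDim_of_le_three`); the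
  rungs `d = 4, 6` work only on the Weil column (part VIII and §L).
* §L THE FIRST RUNG WITH AN OPEN TRANSPORT INPUT, `d = 4`: `CMAnchoredTransportAtRelDim d` is a theorem for `d ≤ 3`
  (andre-2, `cmAnchoredTransportAtRelDim_of_le_three`) and OPEN from `d = 4`; `(5)_4 ⟹[h₈] T@4`, and with the
  `E`-power Weil habitat `(W_E)₂` it returns the algebraicity of the Weil classes on ALL abelian FOURFOLDS of Weil
  type — i.e. exactly the STATEMENT of the tree's named fact `Markman2025_weilClasses_algebraic_abelianFourfold`
  (Markman 2025, a theorem in print): a CONSISTENCY row, not new content; the first rung whose output is open in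
  print is `d = 6` (part VIII §B, `WeilSixfolds`), the first with open `HC` for a whole dimension is `d = 8`
  (part VII, `HCAtDim 4`).

STATUS OF THE LADDER `(5∀)_d` after this part (kernel / print): `d = 0` kernel (VII §D, degenerate); `d = 1` kernel
(§I); `d = 2` PRINT (Tankeev 2011: `B` for threefolds of Kodaira dimension `< 3`, recorded by the literature layer as
the named fact `Tankeev2011.Tankeev2011_lefschetzStandard_abelianSurfacePencilThreefold` in a companion proposal and
consumed in part X, not here) and kernel-reduced to the `(2,2)`-classes of the sixfold squares (§J); `d = 3`
print-PARTIAL only (Tankeev: Néron models of abelian threefolds WITH degenerate fibres of multiplicative type —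
not the compact-pencil case); `d ≥ 4` OPEN. NOT CLAIMED: `HC_AV ⟹ (5)_d`; monotonicity of `(5)_d`, `(5∀)_d` or
`CMAnchoredTransportAtRelDim d` in `d`; minimality of any node; any discharge of `h₈`, `h₂₁`.

References: Andre1996Motifs (§6.3, Lemme 6.3.1, Lemme 6.3.3, Remarque 2 p. 33); Abdulali1994FamiliesAV (pp. 1122–1123);
GreenMurreVoisin1994 (Murre §7.7); Kleiman1968AlgebraicCycles (§2); Grothendieck1968 (§3); Voisin2025 (§3.2.2 (15)–(16),
Conj. 3.11); VoisinHodgeI2002 (§11.3); vanGeemen1994HodgeAV (Thm. 4.3); Markman2025SurveySecant (Thm. 1.2);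
Tankeev2011; Tankeev2020 (Introduction). No `sorry`, no new axiom, no definition; every theorem is a short
instantiation.
-/

noncomputable section

-- The summit's namespace repeats `HodgeConjecture` (summit = sub-problem); every file of the axis disables this linter.
set_option linter.dupNamespace false

namespace Summit.HodgeConjecture.HodgeConjecture.Ring2.AbelianAll

open CategoryTheory AlgebraicGeometry MonoidalCategory
open Literature.AlgebraicGeometry Literature.AlgebraicGeometry.Motives
open Literature.AlgebraicGeometry.HodgeTheory
open Literature.AlgebraicGeometry.Abdulali1994 (Abdulali1994_invariantCycles_of_lefschetzStandard)
open Literature.AlgebraicGeometry.Andre1996 (andre1996_cmAnchoredPencil)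
open Literature.AlgebraicGeometry.Deligne1982 (cmLocus)
open Summit.HodgeConjecture.HodgeConjecture
open Summit.HodgeConjecture.HodgeConjecture.Theses
open Summit.HodgeConjecture.HodgeConjecture.Ring2.ClassTargets (HCAtDim HCUpToDim hcAtDim_mono hcAtDim_of_le_three
  hodgeAbelianVarieties_iff_forall_hcAtDim)

/-! ## §I The rungs `d ≤ 1` are theorems of the tree -/

/-- **`(5∀)_1` holds: conjecture `B` for the total space of every compact pencil of ELLIPTIC CURVES** — the total
space is a smooth projective SURFACE (`IsCompactAbelianPencil.isSmoothProjective_total`), and `B(S)` holds for every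
smooth projective complex surface and every polarisation, unconditionally on the carriers (literature seat,
`standardConjectureBStar_of_isCompactAbelianPencil_one` ← `standardConjectureBStar_surface`: the degrees `a ≤ 2` are
`Lʲ`, `a = 3` is Lefschetz `(1,1)` on `S × S`, `a = 4` is codimension `0`). The first rung of André's Remarque 2 with
Hodge-theoretic content in its statement, still without content for `HC` (§K).
[cite: GreenMurreVoisin1994, Murre §7.7 (PDF p. 123)] [cite: Andre1996Motifs, §6.3 Remarque 2 (p. 33)]
[cite: Kleiman1968AlgebraicCycles, §2] -/
theorem lefschetzBCompactPencilsAtRelDim_one : LefschetzBCompactPencilsAtRelDim 1 :=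
  fun _ _ _ hf η ↦ standardConjectureBStar_of_isCompactAbelianPencil_one hf η

/-- `(5)_1` holds (from `(5∀)_1`). [cite: GreenMurreVoisin1994, Murre §7.7 (PDF p. 123)] -/
theorem lefschetzBCMPointedPencilsAtRelDim_one : LefschetzBCMPointedPencilsAtRelDim 1 :=
  lefschetzBCMPointedPencilsAtRelDim_of_lefschetzBCompactPencilsAtRelDim lefschetzBCompactPencilsAtRelDim_one

/-- `(5∀)_d` for every `d ≤ 1` (part VII's foot `d = 0` and §I's `d = 1`). [cite: GreenMurreVoisin1994, Murre §7.7 (PDF p. 123)] -/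
theorem lefschetzBCompactPencilsAtRelDim_of_le_one {d : ℕ} (hd : d ≤ 1) : LefschetzBCompactPencilsAtRelDim d := by
  interval_cases d
  · exact lefschetzBCompactPencilsAtRelDim_zero
  · exact lefschetzBCompactPencilsAtRelDim_one

/-- `(5)_d` for every `d ≤ 1`. [cite: GreenMurreVoisin1994, Murre §7.7 (PDF p. 123)] -/
theorem lefschetzBCMPointedPencilsAtRelDim_of_le_one {d : ℕ} (hd : d ≤ 1) : LefschetzBCMPointedPencilsAtRelDim d :=
  lefschetzBCMPointedPencilsAtRelDim_of_lefschetzBCompactPencilsAtRelDim (lefschetzBCompactPencilsAtRelDim_of_le_one hd)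

/-- **The blanket node (5∀) (`LefschetzBCompactPencils`, all relative dimensions) is EQUIVALENT to its restriction to
relative dimension `d ≥ 2`** (threefold total spaces and up), unconditionally. [cite: Andre1996Motifs, §6.3 Remarque 2 (p. 33)]
[cite: GreenMurreVoisin1994, Murre §7.7 (PDF p. 123)] -/
theorem lefschetzBCompactPencils_iff_forall_two_le :
    LefschetzBCompactPencils ↔ ∀ d : ℕ, 2 ≤ d → LefschetzBCompactPencilsAtRelDim d := by
  refine lefschetzBCompactPencils_iff_forall_atRelDim.trans ⟨fun h d _ ↦ h d, fun h d ↦ ?_⟩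
  rcases Nat.lt_or_ge d 2 with hd | hd
  · exact lefschetzBCompactPencilsAtRelDim_of_le_one (by omega)
  · exact h d hd

/-- The same for the CM-pointed node (5) (`LefschetzBCMPointedPencils`). [cite: Andre1996Motifs, §6.3 Remarque 2 (p. 33)] -/
theorem lefschetzBCMPointedPencils_iff_forall_two_le :
    LefschetzBCMPointedPencils ↔ ∀ d : ℕ, 2 ≤ d → LefschetzBCMPointedPencilsAtRelDim d := by
  refine lefschetzBCMPointedPencils_iff_forall_atRelDim.trans ⟨fun h d _ ↦ h d, fun h d ↦ ?_⟩
  rcases Nat.lt_or_ge d 2 with hd | hd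
  · exact lefschetzBCMPointedPencilsAtRelDim_of_le_one (by omega)
  · exact h d hd

/-! ## §J The exact degree cost of `(5∀)_d`: codimensions `2 ≤ b ≤ d` of `HC(𝒳 × 𝒳)` only -/

/-- **`(5∀)_d` from the rational `(b,b)`-classes of the `(2d+2)`-folds `𝒳 × 𝒳` in codimensions `2 ≤ b ≤ d` ONLY**
(`𝒳` the `(d+1)`-dimensional total space of a compact pencil of abelian `d`-folds): the degrees `a ≤ d + 1` of `*_L`
are powers of `L`, `b = 1` is Lefschetz `(1,1)` on `𝒳 × 𝒳`, `b = 0` is free, and `*_L : Hᵃ → Hᵇ` for `a > d + 1`,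
`b ≥ 2` costs exactly the codimension-`b` classes (literature seat, `standardConjectureBStar_of_hodgeClasses_prod_algebraic_range`).
Sharper than part VII's `lefschetzBCompactPencilsAtRelDim_of_hodgeConjectureFor_sq` (all codimensions). Fact-free.
[cite: Voisin2025, §3.2.2 (15)–(16) and Conj. 3.11] [cite: Kleiman1968AlgebraicCycles, §2] -/
theorem lefschetzBCompactPencilsAtRelDim_of_hodgeClasses_sq_range {d : ℕ}
    (h : ∀ ⦃𝒳 S : SchemeOver ℂ⦄ (f : 𝒳 ⟶ S), IsCompactAbelianPencil f d →
      ∀ b, 2 ≤ b → b ≤ d → ∀ c : complexBetti (𝒳 ⊗ 𝒳) (2 * b), IsRationalClass c →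
        IsOfHodgeType (d + 1 + (d + 1)) (𝒳 ⊗ 𝒳) (2 * b) b b c → c ∈ algebraicClasses (𝒳 ⊗ 𝒳) b) :
    LefschetzBCompactPencilsAtRelDim d :=
  fun _ _ f hf η ↦ standardConjectureBStar_of_hodgeClasses_prod_algebraic_range hf.isSmoothProjective_total
    (fun b h2 hlt ↦ h f hf b h2 (by omega)) η

/-- The CM-pointed variant: `(5)_d` from the same classes on the squares of the CM-POINTED pencils only.
[cite: Voisin2025, §3.2.2 (15)–(16) and Conj. 3.11] [cite: Andre1996Motifs, §6.3 a) (p. 33)] -/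
theorem lefschetzBCMPointedPencilsAtRelDim_of_hodgeClasses_sq_range {d : ℕ}
    (h : ∀ ⦃𝒳 S : SchemeOver ℂ⦄ (f : 𝒳 ⟶ S), IsCompactAbelianPencil f d → (cmLocus f d).Nonempty →
      ∀ b, 2 ≤ b → b ≤ d → ∀ c : complexBetti (𝒳 ⊗ 𝒳) (2 * b), IsRationalClass c →
        IsOfHodgeType (d + 1 + (d + 1)) (𝒳 ⊗ 𝒳) (2 * b) b b c → c ∈ algebraicClasses (𝒳 ⊗ 𝒳) b) :
    LefschetzBCMPointedPencilsAtRelDim d :=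
  fun _ _ f hf hcm η ↦ standardConjectureBStar_of_hodgeClasses_prod_algebraic_range hf.isSmoothProjective_total
    (fun b h2 hlt ↦ h f hf hcm b h2 (by omega)) η

/-- **The rung `d = 2` reduced: `(5∀)_2` (conjecture `B` for the THREEFOLD total spaces of compact pencils of abelian
surfaces) follows from the algebraicity of the rational `(2,2)`-classes of the SIXFOLDS `𝒳 × 𝒳`** — the single
remaining degree `*_L : H⁴(𝒳) → H²(𝒳)` (literature seat, `standardConjectureBStar_threefold_of_codimTwo`). In print
`(5∀)_2` is a THEOREM (Tankeev 2011, threefolds of Kodaira dimension `< 3`; part X consumes the named fact); this is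
its fact-free kernel reduction. [cite: Voisin2025, §3.2.2 Conj. 3.11 (k = 2)] [cite: Tankeev2011, main theorem] -/
theorem lefschetzBCompactPencilsAtRelDim_two_of_codimTwo_sq
    (h : ∀ ⦃𝒳 S : SchemeOver ℂ⦄ (f : 𝒳 ⟶ S), IsCompactAbelianPencil f 2 →
      ∀ c : complexBetti (𝒳 ⊗ 𝒳) (2 * 2), IsRationalClass c →
        IsOfHodgeType (3 + 3) (𝒳 ⊗ 𝒳) (2 * 2) 2 2 c → c ∈ algebraicClasses (𝒳 ⊗ 𝒳) 2) :
    LefschetzBCompactPencilsAtRelDim 2 :=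
  fun _ _ f hf η ↦ standardConjectureBStar_threefold_of_codimTwo hf.isSmoothProjective_total (h f hf) η

/-! ## §K Cofinality of the cell row in the relative dimension -/

/-- **COFINALITY (transport form): `HC_CM ∧ (CMAnchoredTransportAtRelDim (2g) for a COFINAL set of g) ⟹ HC_AV`**,
granted Lemme 6.3.1 (`h₂₁`) — andre-2's graded row `HC_CM ∧ T@(2g) ⟹ HCAtDim g` composed with the monotonicity of the
dimension rows (`ClassTargets.hcAtDim_mono`: `HC` in dimension `g'` gives it in every dimension `g ≤ g'`, by the product
trick). research route, not a corollary; conditional on HC_CM plus one named minimal statement.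
[cite: Andre1996Motifs, Lemme 6.3.1 (p. 31) and §6.3 a) (p. 33)] [cite: VoisinHodgeI2002, §11.3] -/
theorem hodgeAbelianVarieties_of_HC_CM_of_frequently_cmAnchoredTransportAtRelDim (h₂₁ : andre1996_cmAnchoredPencil)
    (hCM : RankFourFaces.CMAbelianHodge) (hT : ∀ N : ℕ, ∃ g, N ≤ g ∧ CMAnchoredTransportAtRelDim (2 * g)) :
    PadicSemiregularLift.HodgeAbelianVarieties :=
  hodgeAbelianVarieties_iff_forall_hcAtDim.2 fun N ↦ by
    obtain ⟨g, hNg, hTg⟩ := hT N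
    exact hcAtDim_mono hNg (hcAtDim_of_HC_CM_of_cmAnchoredTransportAtRelDim h₂₁ hCM g hTg)

/-- **COFINALITY (Lefschetz form): `HC_CM ∧ ((5)_{2g} for a COFINAL set of g) ⟹ HC_AV`**, granted `h₈` (Abdulali) and
`h₂₁` (Lemme 6.3.1): conjecture `B` for the total spaces of CM-pointed compact pencils of abelian `2g`-folds, for
arbitrarily large `g` only. research route, not a corollary; conditional on HC_CM plus one named minimal statement.
[cite: Andre1996Motifs, §6.3 Remarque 2 (p. 33)] [cite: Abdulali1994FamiliesAV, pp. 1122–1123] [cite: VoisinHodgeI2002, §11.3] -/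
theorem hodgeAbelianVarieties_of_HC_CM_of_abdulali_of_frequently_lefschetzBCMPointedPencilsAtRelDim
    (h₈ : Abdulali1994_invariantCycles_of_lefschetzStandard) (h₂₁ : andre1996_cmAnchoredPencil)
    (hCM : RankFourFaces.CMAbelianHodge) (hB : ∀ N : ℕ, ∃ g, N ≤ g ∧ LefschetzBCMPointedPencilsAtRelDim (2 * g)) :
    PadicSemiregularLift.HodgeAbelianVarieties :=
  hodgeAbelianVarieties_of_HC_CM_of_frequently_cmAnchoredTransportAtRelDim h₂₁ hCM fun N ↦ by
    obtain ⟨g, hNg, hBg⟩ := hB N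
    exact ⟨g, hNg, cmAnchoredTransportAtRelDim_of_abdulali_of_lefschetzBCMPointedPencilsAtRelDim h₈ hBg⟩

/-- **`HC_CM ∧ (∀ g ≥ 4, (5)_{2g}) ⟹ HC_AV`**, granted `h₈`, `h₂₁`: the rungs `(5)_{2g}`, `g ≤ 3` (relative dimension
`≤ 6`), are IDLE for `HC_AV` through the Lemme 6.3.1 row — they return `HCAtDim g`, `g ≤ 3`, a theorem of the tree
(`ClassTargets.hcAtDim_of_le_three`). research route, not a corollary; conditional on HC_CM plus one named minimal statement.
[cite: Andre1996Motifs, Lemme 6.3.1 (p. 31) and Remarque 2 (p. 33)] [cite: Abdulali1994FamiliesAV, pp. 1122–1123]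
[cite: VoisinHodgeII2003, §10.2.3] -/
theorem hodgeAbelianVarieties_of_HC_CM_of_abdulali_of_forall_ge_four_lefschetzBCMPointedPencilsAtRelDim
    (h₈ : Abdulali1994_invariantCycles_of_lefschetzStandard) (h₂₁ : andre1996_cmAnchoredPencil)
    (hCM : RankFourFaces.CMAbelianHodge) (hB : ∀ g : ℕ, 4 ≤ g → LefschetzBCMPointedPencilsAtRelDim (2 * g)) :
    PadicSemiregularLift.HodgeAbelianVarieties :=
  hodgeAbelianVarieties_iff_forall_hcAtDim.2 fun g ↦ by
    rcases Nat.lt_or_ge g 4 with hg | hg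
    · exact hcAtDim_of_le_three (by omega)
    · exact hcAtDim_of_HC_CM_of_abdulali_of_lefschetzBCMPointedPencilsAtRelDim_double h₈ h₂₁ hCM g (hB g hg)

/-- The same from the blanket graded nodes: `HC_CM ∧ (∀ d ≥ 8, (5∀)_d) ⟹ HC_AV`, granted `h₈`, `h₂₁` (conjecture `B` for
the total spaces, of dimension `≥ 9`, of ALL compact pencils of abelian varieties of relative dimension `≥ 8`).
research route, not a corollary; conditional on HC_CM plus one named minimal statement.
[cite: Andre1996Motifs, §6.3 Remarque 2 (p. 33)] [cite: Abdulali1994FamiliesAV, pp. 1122–1123] -/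
theorem hodgeAbelianVarieties_of_HC_CM_of_abdulali_of_forall_ge_eight_lefschetzBCompactPencilsAtRelDim
    (h₈ : Abdulali1994_invariantCycles_of_lefschetzStandard) (h₂₁ : andre1996_cmAnchoredPencil)
    (hCM : RankFourFaces.CMAbelianHodge) (hB : ∀ d : ℕ, 8 ≤ d → LefschetzBCompactPencilsAtRelDim d) :
    PadicSemiregularLift.HodgeAbelianVarieties :=
  hodgeAbelianVarieties_of_HC_CM_of_abdulali_of_forall_ge_four_lefschetzBCMPointedPencilsAtRelDim h₈ h₂₁ hCM
    fun g hg ↦ lefschetzBCMPointedPencilsAtRelDim_of_lefschetzBCompactPencilsAtRelDim (hB (2 * g) (by omega))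

/-! ## §L The first rung with an open transport input: `d = 4`, the Weil FOURFOLDS (a consistency row) -/

/-- **`(W_E)₂ ∧ (5)_4 ⟹[h₈]` the Weil classes on ALL abelian fourfolds of Weil type are algebraic — i.e. the STATEMENT
of Markman's theorem (`Markman2025_weilClasses_algebraic_abelianFourfold`, a theorem in print, here a CONCLUSION, not a
hypothesis); NO `HC_CM`.** Conjecture `B` for the five-dimensional total spaces of CM-pointed compact pencils of abelian
fourfolds gives, through Abdulali's transport (`h₈`), `CMAnchoredTransportAtRelDim 4` — the first relative dimension in
which that transport is NOT a theorem of the tree (`cmAnchoredTransportAtRelDim_of_le_three`) — and on the `E`-power Weil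
habitat `(W_E)₂` (ab-andre-2 IX) Tate's theorem at the CM fibre plus transport reads every Weil class
(`mem_algebraicClasses_of_cmPowerWeilPencilsAt_of_transport`). A CONSISTENCY row (its conclusion is known in print);
the first rung whose output is open in print is `d = 6` (part VIII §B). [cite: Markman2025SurveySecant, Thm. 1.2 and §11.5 Step 2]
[cite: Abdulali1994FamiliesAV, pp. 1122–1123] [cite: vanGeemen1994HodgeAV, Thm. 4.3] [cite: Andre1996Motifs, Lemme 6.3.3 (p. 33)] -/
theorem markman2025Fourfold_of_abdulali_of_cmPowerWeilPencilsAt_two_of_lefschetzBCMPointedPencilsAtRelDim_four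
    (h₈ : Abdulali1994_invariantCycles_of_lefschetzStandard)
    (hW : CMPowerAnchoredCompactWeilPencilsAt 2) (hB : LefschetzBCMPointedPencilsAtRelDim 4) :
    Markman2025_weilClasses_algebraic_abelianFourfold :=
  fun _ hd _ _ hAdim hA hφ _ hcQ hcH hcW ↦
    mem_algebraicClasses_of_cmPowerWeilPencilsAt_of_transport hW
      (cmAnchoredTransportAtRelDim_of_abdulali_of_lefschetzBCMPointedPencilsAtRelDim h₈ hB) hd hAdim hA hφ hcQ hcH hcW

/-- The same from the blanket node `(5∀)_4` (conjecture `B` for the total spaces of ALL compact pencils of abelian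
fourfolds). [cite: Markman2025SurveySecant, Thm. 1.2] [cite: Abdulali1994FamiliesAV, pp. 1122–1123] -/
theorem markman2025Fourfold_of_abdulali_of_cmPowerWeilPencilsAt_two_of_lefschetzBCompactPencilsAtRelDim_four
    (h₈ : Abdulali1994_invariantCycles_of_lefschetzStandard)
    (hW : CMPowerAnchoredCompactWeilPencilsAt 2) (hB : LefschetzBCompactPencilsAtRelDim 4) :
    Markman2025_weilClasses_algebraic_abelianFourfold :=
  markman2025Fourfold_of_abdulali_of_cmPowerWeilPencilsAt_two_of_lefschetzBCMPointedPencilsAtRelDim_four h₈ hW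
    (lefschetzBCMPointedPencilsAtRelDim_of_lefschetzBCompactPencilsAtRelDim hB)

/-- Transport form of the same row (no `h₈`, no Lefschetz input): `(W_E)₂ ∧ CMAnchoredTransportAtRelDim 4 ⟹` Markman's
fourfold statement — the relative dimension `4` is the first where andre-2's transport node is open, and this is what
it buys on the Weil column. [cite: Markman2025SurveySecant, Thm. 1.2] [cite: vanGeemen1994HodgeAV, Thm. 4.3] -/
theorem markman2025Fourfold_of_cmPowerWeilPencilsAt_two_of_cmAnchoredTransportAtRelDim_four
    (hW : CMPowerAnchoredCompactWeilPencilsAt 2) (hT : CMAnchoredTransportAtRelDim 4) :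
    Markman2025_weilClasses_algebraic_abelianFourfold :=
  fun _ hd _ _ hAdim hA hφ _ hcQ hcH hcW ↦
    mem_algebraicClasses_of_cmPowerWeilPencilsAt_of_transport hW hT hd hAdim hA hφ hcQ hcH hcW

#print axioms lefschetzBCompactPencilsAtRelDim_one
#print axioms lefschetzBCompactPencils_iff_forall_two_le
#print axioms hodgeAbelianVarieties_of_HC_CM_of_abdulali_of_forall_ge_four_lefschetzBCMPointedPencilsAtRelDim
#print axioms markman2025Fourfold_of_abdulali_of_cmPowerWeilPencilsAt_two_of_lefschetzBCMPointedPencilsAtRelDim_four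

end Summit.HodgeConjecture.HodgeConjecture.Ring2.AbelianAll

end
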